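import Literature.RingTheory.CohomologyAnnihilator.AnnihilationOfCohomologyProofs
import HarnessLib

/-!
# Strong generators of `mod A` and the cohomology annihilator (Iyengar–Takahashi, §4)

Topic: `Literature/RingTheory/CohomologyAnnihilator`. The module-building vocabulary of
[IyengarTakahashi2014, Definition 4.1] for a commutative ring `A` and a single module `G`
(`add G`, the tower `|G|ₙ`), syzygy modules `Ωˢ M` as a predicate, and the PROVED chain
Lemma 2.14 (the half `ann Ext^n(M, Ωⁿ M) ⊆ ann Ext^{≥ n}(M, −)`, via Remark 2.13) →
Lemma 4.2 (`Iⁿ · Ext^{≥1}(M, −) = 0` for `M ∈ |G|ₙ`, in the form with `Ext^{≥ l}` for any `l`) →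
the processing step of the proof of Theorem 4.3, ending in

* `singEqVCa_essFiniteType_of_strongGenerator` — **Theorem 5.4** of [IyengarTakahashi2014]
  (`V(ca R) = V(ca^{2d+1} R) = Sing R` for localisations of a finitely generated algebra `A` of
  Krull dimension `d` over a field, the named fact `singEqVCa_essFiniteType`) DERIVED from the
  printed strong-generation statement of the same theorem, "there is a finitely generated module
  `G` such that `Ω^d(mod A) ⊆ |G|ₙ` for some `n`", taken as an explicit hypothesis in the
  vocabulary of this file (every finitely generated module has a `d`-th syzygy in
  `InTower G n`). What remains unproved in the tree is exactly that existence statement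
  (Theorems 3.6, 5.1, 5.2, Lemma 4.8 and the base change to `k̄` of [IyengarTakahashi2014, §§3–5]).

Design: `add G` is "retract of a finite power `Gᵐ`" (`IsRetractOfPower`); `M ∈ |G|ₙ` is the
inductive clause of Definition 4.1 ("`0 → Y → M ⊕ W → X → 0` with `Y ∈ |G|ₙ₋₁`, `X ∈ add G`";
`|G|₀ = {0}`), `InTower`; "`K` is an `s`-th syzygy of `M`" (`IsSyzygy`) is a chain of `s` short
exact sequences with finitely generated projective middle terms (any such chain: syzygies are
only defined up to projective summands, Schanuel). `extAnnihilatorFrom G l` is the ideal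
`ann_A Ext^{≥ l}_A(G, mod A)`. Everything is over Mathlib's `CategoryTheory.Abelian.Ext` in
`ModuleCat.{u} A`, as in `Basic.lean`.

## References

* S. B. Iyengar, R. Takahashi, *Annihilation of cohomology and strong generation of module
  categories*, IMRN 2016; arXiv:1404.1476 — Def. 4.1, Remark 2.13, Lemma 2.14, Lemma 4.2,
  Theorem 4.3 (proof), Theorem 5.4. [`IyengarTakahashi2014`]
-/

noncomputable section

open CategoryTheory CategoryTheory.Abelian CategoryTheory.Limits

universe u

namespace Literature.RingTheory.CohomologyAnnihilator

variable {A : Type u} [CommRing A]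

/-! ## Definition 4.1: `add G`, the tower `|G|ₙ`, syzygies -/

/-- `X ∈ add G`: `X` is a direct summand (retract) of a finite direct sum `Gᵐ` of copies of `G`
("`add 𝒳` … direct summands of finite direct sums of copies of the modules in `𝒳`", for
`𝒳 = {G}`). [cite: IyengarTakahashi2014, Def. 4.1] -/
def IsRetractOfPower (G X : ModuleCat.{u} A) : Prop :=
  ∃ (m : ℕ) (i : X ⟶ ModuleCat.of A (Fin m → G)) (p : ModuleCat.of A (Fin m → G) ⟶ X),
    i ≫ p = 𝟙 X

/-- `M ∈ |G|ₙ` (Iyengar–Takahashi's tower built out of `G`): `|G|₀ = {0}`, and `M ∈ |G|ₙ₊₁` iff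
there is an exact sequence `0 → Y → M ⊕ W → X → 0` with `Y ∈ |G|ₙ` and `X ∈ add G` (so
`|G|₁ = add G`). [cite: IyengarTakahashi2014, Def. 4.1] -/
def InTower (G : ModuleCat.{u} A) : ℕ → ModuleCat.{u} A → Prop
  | 0, M => IsZero M
  | n + 1, M => ∃ (W Y X : ModuleCat.{u} A), InTower G n Y ∧ IsRetractOfPower G X ∧
      ∃ (f : Y ⟶ ModuleCat.of A (M × W)) (g : ModuleCat.of A (M × W) ⟶ X) (w : f ≫ g = 0),
        (ShortComplex.mk f g w).ShortExact

/-- "`K` is an `s`-th syzygy module `Ωˢ M` of `M`": `Ω⁰ M ≅ M`, and an `(s+1)`-th syzygy is the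
kernel `0 → K → P → K' → 0` of a surjection from a finitely generated projective `P` onto an
`s`-th syzygy `K'` ("the kernel of any surjective `P ↠ M` with `P` projective … finitely
generated"). [cite: IyengarTakahashi2014, §2 (Syzygy modules)] -/
def IsSyzygy : ℕ → ModuleCat.{u} A → ModuleCat.{u} A → Prop
  | 0, M, K => Nonempty (K ≅ M)
  | s + 1, M, K => ∃ (K' P : ModuleCat.{u} A), IsSyzygy s M K' ∧ Module.Finite A P ∧
      Projective P ∧ ∃ (f : K ⟶ P) (g : P ⟶ K') (w : f ≫ g = 0), (ShortComplex.mk f g w).ShortExact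

/-- The ideal `ann_A Ext^{≥ l}_A(G, mod A)` of elements killing `Extⁱ_A(G, N)` for all `i ≥ l` and
all finitely generated `N` (so that `caˡ(A) = ⋂_G extAnnihilatorFrom G l` over finitely generated
`G`). [cite: IyengarTakahashi2014, Lemma 2.14] -/
def extAnnihilatorFrom (G : ModuleCat.{u} A) (l : ℕ) : Ideal A :=
  ⨅ (i : ℕ) (_ : l ≤ i) (N : ModuleCat.{u} A) (_ : Module.Finite A N),
    Module.annihilator A (Ext.{u} G N i)

/-- Unfolding of `extAnnihilatorFrom`. [cite: IyengarTakahashi2014, Lemma 2.14] -/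
theorem mem_extAnnihilatorFrom_iff {G : ModuleCat.{u} A} {l : ℕ} {a : A} :
    a ∈ extAnnihilatorFrom G l ↔ ∀ i : ℕ, l ≤ i → ∀ N : ModuleCat.{u} A, Module.Finite A N →
      ∀ e : Ext.{u} G N i, a • e = 0 := by
  simp [extAnnihilatorFrom, Module.mem_annihilator]

/-- `caˡ(A) ⊆ ann Ext^{≥ l}(G, mod A)` for finitely generated `G`, and conversely an element of all
of the latter lies in `caˡ(A)`: membership in `caˡ(A)` is membership in every
`extAnnihilatorFrom G l`, `G` finitely generated. [cite: IyengarTakahashi2014, Def. 2.1] -/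
theorem mem_cohomologyAnnihilatorOfDegree_iff_forall_mem_extAnnihilatorFrom {l : ℕ} {a : A} :
    a ∈ cohomologyAnnihilatorOfDegree A l ↔
      ∀ G : ModuleCat.{u} A, Module.Finite A G → a ∈ extAnnihilatorFrom G l := by
  simp only [mem_cohomologyAnnihilatorOfDegree_iff, mem_extAnnihilatorFrom_iff]
  exact ⟨fun h G hG i hi N hN e => h i hi G N hG hN e, fun h i hi M N hM hN e => h M hM i hi N hN e⟩

/-! ## Annihilation transported along retracts, powers and short exact sequences -/

/-- If `a` kills `Extⁿ(Z, N)` and `X` is a retract of `Z` then `a` kills `Extⁿ(X, N)`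
(`e = i^*(p^* e)`). [folklore] -/
theorem ext_smul_eq_zero_of_retract {X Z N : ModuleCat.{u} A} (i : X ⟶ Z) (p : Z ⟶ X)
    (h : i ≫ p = 𝟙 X) {n : ℕ} (a : A) (hZ : ∀ e : Ext.{u} Z N n, a • e = 0) (e : Ext.{u} X N n) :
    a • e = 0 := by
  have he : e = (Ext.mk₀ i).comp ((Ext.mk₀ p).comp e (zero_add n)) (zero_add n) := by
    rw [Ext.mk₀_comp_mk₀_assoc, h, Ext.mk₀_id_comp]
  rw [he, ← Ext.comp_smul, hZ, Ext.comp_zero]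

/-- If `a` kills `Extⁿ(G, N)` then it kills `Extⁿ(Gᵐ, N)` (`𝟙 = Σⱼ πⱼ ≫ ιⱼ` on `Gᵐ`, and `Ext` is
additive). [folklore] -/
theorem ext_smul_eq_zero_of_pi {G N : ModuleCat.{u} A} {n : ℕ} (a : A)
    (hG : ∀ e : Ext.{u} G N n, a • e = 0) (m : ℕ) (e : Ext.{u} (ModuleCat.of A (Fin m → G)) N n) :
    a • e = 0 := by
  let π : Fin m → (ModuleCat.of A (Fin m → G) ⟶ G) := fun j => ModuleCat.ofHom (LinearMap.proj j)
  let ι : Fin m → (G ⟶ ModuleCat.of A (Fin m → G)) :=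
    fun j => ModuleCat.ofHom (LinearMap.single A (fun _ => G) j)
  have hid : ∑ j, π j ≫ ι j = 𝟙 (ModuleCat.of A (Fin m → G)) := by
    apply ModuleCat.hom_ext
    refine LinearMap.ext fun v => ?_
    simp only [ModuleCat.hom_sum, ModuleCat.hom_comp, LinearMap.coe_sum, Finset.sum_apply,
      LinearMap.coe_comp, Function.comp_apply, ModuleCat.hom_id, LinearMap.id_coe, id_eq]
    conv_rhs => rw [← Finset.univ_sum_single v]
    simp [π, ι]
  have he : e = ∑ j, (Ext.mk₀ (π j)).comp ((Ext.mk₀ (ι j)).comp e (zero_add n)) (zero_add n) := by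
    simp only [Ext.mk₀_comp_mk₀_assoc]
    rw [← Ext.sum_comp, ← Ext.mk₀_sum, hid, Ext.mk₀_id_comp]
  rw [he, Finset.smul_sum]
  refine Finset.sum_eq_zero fun j _ => ?_
  rw [← Ext.comp_smul, hG, Ext.comp_zero]

/-- If `X ∈ add G` and `a` kills `Extⁿ(G, N)` then `a` kills `Extⁿ(X, N)`.
[cite: IyengarTakahashi2014, Lemma 4.2 (proof, base case)] -/
theorem ext_smul_eq_zero_of_isRetractOfPower {G X N : ModuleCat.{u} A} (hX : IsRetractOfPower G X)
    {n : ℕ} (a : A) (hG : ∀ e : Ext.{u} G N n, a • e = 0) (e : Ext.{u} X N n) : a • e = 0 := by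
  obtain ⟨m, i, p, h⟩ := hX
  exact ext_smul_eq_zero_of_retract i p h a (ext_smul_eq_zero_of_pi a hG m) e

/-- The middle term of a short exact sequence `0 → X₁ → X₂ → X₃ → 0`: if `b` kills `Extⁿ(X₁, N)`
and `c` kills `Extⁿ(X₃, N)` then `b c` kills `Extⁿ(X₂, N)` (exactness of
`Extⁿ(X₃, N) → Extⁿ(X₂, N) → Extⁿ(X₁, N)`). [cite: IyengarTakahashi2014, Lemma 4.2 (proof)] -/
theorem ext_smul_eq_zero_of_shortExact {S : ShortComplex (ModuleCat.{u} A)} (hS : S.ShortExact)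
    {N : ModuleCat.{u} A} {n : ℕ} (b c : A) (h₁ : ∀ e : Ext.{u} S.X₁ N n, b • e = 0)
    (h₃ : ∀ e : Ext.{u} S.X₃ N n, c • e = 0) (e : Ext.{u} S.X₂ N n) : (b * c) • e = 0 := by
  have hb : (Ext.mk₀ S.f).comp (b • e) (zero_add n) = 0 := by
    rw [Ext.comp_smul, h₁]
  obtain ⟨x₁, hx₁⟩ := Ext.contravariant_sequence_exact₂ hS N (b • e) hb
  rw [mul_comm, mul_smul, ← hx₁, ← Ext.comp_smul, h₃, Ext.comp_zero]

/-- `Ext` out of a zero object vanishes. [folklore] -/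
theorem ext_eq_zero_of_isZero {M N : ModuleCat.{u} A} (hM : IsZero M) {n : ℕ} (e : Ext.{u} M N n) :
    e = 0 := by
  rw [← Ext.mk₀_id_comp e, hM.eq_of_src (𝟙 M) 0, Ext.mk₀_zero, Ext.zero_comp]

/-! ## Lemma 4.2 (with `Ext^{≥ l}` in place of `Ext^{≥ 1}`) -/

/-- **Lemma 4.2** (generalised in the degree range): for `M ∈ |G|ₙ`,
`(ann Ext^{≥ l}(G, mod A))ⁿ · Ext^{≥ l}(M, mod A) = 0`, i.e.
`(extAnnihilatorFrom G l)ⁿ ⊆ extAnnihilatorFrom M l`. Induction on `n` along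
`0 → Y → M ⊕ W → X → 0`: `Iⁿ⁻¹` kills `Ext(Y, −)`, `I` kills `Ext(X, −)` (`X ∈ add G`), so the
product kills `Ext(M ⊕ W, −)` and hence `Ext(M, −)`. (The printed lemma is the case `l = 1` with
`I = ann Ext¹(G, ΩG) = ann Ext^{≥1}(G, −)`, Lemma 2.14.) [cite: IyengarTakahashi2014, Lemma 4.2] -/
theorem pow_extAnnihilatorFrom_le_of_inTower (G : ModuleCat.{u} A) (l : ℕ) :
    ∀ (n : ℕ) (M : ModuleCat.{u} A), InTower G n M →
      extAnnihilatorFrom G l ^ n ≤ extAnnihilatorFrom M l := by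
  intro n
  induction n with
  | zero =>
    intro M hM a _
    rw [mem_extAnnihilatorFrom_iff]
    intro i _ N _ e
    rw [ext_eq_zero_of_isZero hM e, smul_zero]
  | succ n ih =>
    intro M hM
    obtain ⟨W, Y, X, hY, hX, f, g, w, hS⟩ := hM
    rw [pow_succ, Ideal.mul_le]
    intro b hb c hc
    have hbY := ih Y hY hb
    rw [mem_extAnnihilatorFrom_iff] at hbY hc ⊢
    intro i hi N hN e
    have hMW : ∀ x : Ext.{u} (ModuleCat.of A (M × W)) N i, (b * c) • x = 0 :=
      ext_smul_eq_zero_of_shortExact hS b c (hbY i hi N hN)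
        (ext_smul_eq_zero_of_isRetractOfPower hX c (hc i hi N hN))
    exact ext_smul_eq_zero_of_retract (ModuleCat.ofHom (LinearMap.inl A M W))
      (ModuleCat.ofHom (LinearMap.fst A M W)) (by ext; rfl) (b * c) hMW e

/-! ## Dimension shifting along syzygies -/

/-- Surjective direction: if `a` kills `Ext^{≥ l}(Ωˢ M, mod A)` then `a` kills
`Ext^{≥ l+s}(M, mod A)` (the connecting maps `Extʲ(ΩK, N) → Extʲ⁺¹(K, N)` are `A`-linear and onto,
the middle terms being projective). [cite: IyengarTakahashi2014, Remark 2.3] -/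
theorem mem_extAnnihilatorFrom_of_isSyzygy :
    ∀ (s : ℕ) {M K : ModuleCat.{u} A}, IsSyzygy s M K → ∀ {l : ℕ} {a : A},
      a ∈ extAnnihilatorFrom K l → a ∈ extAnnihilatorFrom M (l + s) := by
  intro s
  induction s with
  | zero =>
    intro M K hK l a ha
    obtain ⟨e⟩ := hK
    rw [mem_extAnnihilatorFrom_iff] at ha ⊢
    intro i hi N hN x
    exact ext_smul_eq_zero_of_iso e (Iso.refl N) a (ha i (by omega) N hN) x
  | succ s ih =>
    intro M K hK l a ha
    obtain ⟨K', P, hK', _, hP, f, g, w, hS⟩ := hK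
    have hK'mem : a ∈ extAnnihilatorFrom K' (l + 1) := by
      rw [mem_extAnnihilatorFrom_iff] at ha ⊢
      intro i hi N hN e
      obtain ⟨j, rfl⟩ : ∃ j, i = j + 1 := ⟨i - 1, by omega⟩
      obtain ⟨e', rfl⟩ := precomp_extClass_surjective_of_projective_X₂ N hS j e
      change a • hS.extClass.comp e' (add_comm 1 j) = 0
      rw [← Ext.comp_smul, ha j (by omega) N hN e', Ext.comp_zero]
    have := ih hK' hK'mem
    rwa [show l + 1 + s = l + (s + 1) by omega] at this

/-- Injective direction, in degrees `≥ 1`: if `a` kills `Ext^{j+s}(M, N)` then `a` kills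
`Extʲ(Ωˢ M, N)` for `j ≥ 1` (the connecting maps `Extʲ(ΩK, N) → Extʲ⁺¹(K, N)` are injective for
`j ≥ 1`, their kernel coming from `Extʲ(P, N) = 0`). [cite: IyengarTakahashi2014, Remark 2.3] -/
theorem ext_smul_eq_zero_of_isSyzygy :
    ∀ (s : ℕ) {M K : ModuleCat.{u} A}, IsSyzygy s M K → ∀ (N : ModuleCat.{u} A) (j : ℕ), 1 ≤ j →
      ∀ a : A, (∀ e' : Ext.{u} M N (j + s), a • e' = 0) → ∀ e : Ext.{u} K N j, a • e = 0 := by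
  intro s
  induction s with
  | zero =>
    intro M K hK N j _ a ha e
    obtain ⟨i⟩ := hK
    exact ext_smul_eq_zero_of_iso i.symm (Iso.refl N) a ha e
  | succ s ih =>
    intro M K hK N j hj a ha e
    obtain ⟨K', P, hK', _, hP, f, g, w, hS⟩ := hK
    have hK'a : ∀ e' : Ext.{u} K' N (j + 1), a • e' = 0 :=
      ih hK' N (j + 1) (by omega) a (by rwa [show j + 1 + s = j + (s + 1) by omega])
    -- `δ (a • e) = a • δ e = 0`, and `δ` is injective in degree `j ≥ 1`
    have hδ : hS.extClass.comp (a • e) (add_comm 1 j) = 0 := by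
      rw [Ext.comp_smul]
      exact hK'a _
    obtain ⟨x₂, hx₂⟩ := Ext.contravariant_sequence_exact₁ hS N (a • e) (add_comm 1 j) hδ
    obtain ⟨j', rfl⟩ : ∃ j', j = j' + 1 := ⟨j - 1, by omega⟩
    haveI : Projective (ShortComplex.mk f g w).X₂ := hP
    rw [← hx₂, Ext.eq_zero_of_projective x₂, Ext.comp_zero]

/-! ## Lemma 2.14 (Remark 2.13): `ann Ext^{d+1}(G, Ω^{d+1} G) ⊆ ann Ext^{≥ d+1}(G, −)` -/

/-- **Remark 2.13 / Lemma 2.14, base case**: let `0 → H → P → G' → 0` be exact with `P`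
projective and let `ξ ∈ Ext¹(G', H)` be its class. If `a ξ = 0` then the homothety `a · 𝟙_{G'}`
factors through `P ↠ G'`, hence `a` kills `Extʲ(G', N)` for every `N` and `j ≥ 1`
(`Extʲ(P, N) = 0`). [cite: IyengarTakahashi2014, Lemma 2.14] -/
theorem ext_smul_eq_zero_of_smul_extClass_eq_zero {S : ShortComplex (ModuleCat.{u} A)}
    (hS : S.ShortExact) [Projective S.X₂] {a : A} (ha : a • hS.extClass = 0)
    (N : ModuleCat.{u} A) {j : ℕ} (hj : 1 ≤ j) (e : Ext.{u} S.X₃ N j) : a • e = 0 := by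
  have ha' : (Ext.mk₀ (a • 𝟙 S.X₃)).comp hS.extClass (zero_add 1) = 0 := by
    rw [Ext.mk₀_smul, Ext.smul_comp, Ext.mk₀_id_comp, ha]
  obtain ⟨x₂, hx₂⟩ := Ext.covariant_sequence_exact₃ S.X₃ hS (Ext.mk₀ (a • 𝟙 S.X₃)) (zero_add 1) ha'
  have hae : a • e = (Ext.mk₀ (a • 𝟙 S.X₃)).comp e (zero_add j) := by
    rw [Ext.mk₀_smul, Ext.smul_comp, Ext.mk₀_id_comp]
  obtain ⟨j', rfl⟩ : ∃ j', j = j' + 1 := ⟨j - 1, by omega⟩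
  rw [hae, ← hx₂, Ext.comp_assoc_of_second_deg_zero, Ext.eq_zero_of_projective
    ((Ext.mk₀ S.g).comp e (zero_add _)), Ext.comp_zero]

/-- **Lemma 2.14** (the inclusion `⊇`, which is the one used in Theorem 4.3): for a
`(d+1)`-th syzygy `H = Ω^{d+1} G`,
`ann_A Ext^{d+1}_A(G, H) ⊆ ann_A Ext^{≥ d+1}_A(G, mod A)`. Proof as printed: replacing `G` by
`Ω^d G` (dimension shifting, injective in degrees `≥ 1` and surjective) reduces to `d = 0`, which
is Remark 2.13. [cite: IyengarTakahashi2014, Lemma 2.14] -/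
theorem annihilator_ext_le_extAnnihilatorFrom {G H : ModuleCat.{u} A} {d : ℕ}
    (hH : IsSyzygy (d + 1) G H) :
    Module.annihilator A (Ext.{u} G H (d + 1)) ≤ extAnnihilatorFrom G (d + 1) := by
  intro a ha
  rw [Module.mem_annihilator] at ha
  obtain ⟨K', P, hK', _, hP, f, g, w, hS⟩ := hH
  haveI : Projective (ShortComplex.mk f g w).X₂ := hP
  -- `a` kills `ξ ∈ Ext¹(Ω^d G, H)`, as it kills `Ext^{d+1}(G, H) ↩ Ext¹(Ω^d G, H)`
  have ha' : ∀ e' : Ext.{u} G H (1 + d), a • e' = 0 := by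
    rw [Nat.add_comm 1 d]
    exact ha
  have hξ : a • hS.extClass = 0 := ext_smul_eq_zero_of_isSyzygy d hK' H 1 le_rfl a ha' hS.extClass
  -- hence `a` kills `Ext^{≥1}(Ω^d G, −)`, hence `Ext^{≥ d+1}(G, −)`
  have h1 : a ∈ extAnnihilatorFrom K' 1 := by
    rw [mem_extAnnihilatorFrom_iff]
    intro i hi N _ e
    exact ext_smul_eq_zero_of_smul_extClass_eq_zero hS hξ N hi e
  have := mem_extAnnihilatorFrom_of_isSyzygy d hK' h1
  rwa [add_comm] at this

/-! ## Existence of syzygies -/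

/-- Over a noetherian ring every finitely generated module has finitely generated `s`-th syzygy
modules for every `s` (kernels of surjections from finite free modules, iterated).
[cite: IyengarTakahashi2014, §2 (Syzygy modules)] -/
theorem exists_isSyzygy [IsNoetherianRing A] (M : ModuleCat.{u} A) [Module.Finite A M] :
    ∀ s : ℕ, ∃ K : ModuleCat.{u} A, Module.Finite A K ∧ IsSyzygy s M K
  | 0 => ⟨M, ‹_›, ⟨Iso.refl M⟩⟩
  | s + 1 => by
    obtain ⟨K', hK', hs⟩ := exists_isSyzygy M s
    obtain ⟨P, _, _, _, _, f, surjf⟩ := Module.exists_finite_presentation A K'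
    haveI : Module.Finite A (LinearMap.ker f) := Module.IsNoetherian.finite A _
    refine ⟨ModuleCat.of A (LinearMap.ker f), inferInstance, K', ModuleCat.of A P, hs, ‹_›,
      inferInstance, ModuleCat.ofHom (LinearMap.ker f).subtype, ModuleCat.ofHom f, ?_, ?_⟩
    · ext x
      exact x.2
    · exact LinearMap.shortExact_shortComplexKer surjf

/-! ## Theorem 5.4 from the printed strong generator -/

/-- **Theorem 4.3 (processing of a strong generator), with Theorem 5.4's parameter `s = d`**:
if every finitely generated `A`-module has a `d`-th syzygy in `|G|ₙ`, then for any `(d+1)`-th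
syzygy `H` of `G`,
`(ann_A Ext^{d+1}_A(G, H))ⁿ ⊆ ca^{2d+1}(A)`: by Lemma 2.14 the ideal is contained in
`I = ann Ext^{≥ d+1}(G, −)`, by Lemma 4.2 `Iⁿ` kills `Ext^{≥ d+1}(Ω^d M, −)`, and by dimension
shifting this is `Ext^{≥ 2d+1}(M, −)`. [cite: IyengarTakahashi2014, Thm. 4.3 (proof)] -/
theorem pow_annihilator_ext_le_cohomologyAnnihilatorOfDegree {G : ModuleCat.{u} A} {d n : ℕ}
    (hgen : ∀ M : ModuleCat.{u} A, Module.Finite A M → ∃ K : ModuleCat.{u} A,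
      IsSyzygy d M K ∧ InTower G n K)
    {H : ModuleCat.{u} A} (hH : IsSyzygy (d + 1) G H) :
    Module.annihilator A (Ext.{u} G H (d + 1)) ^ n ≤ cohomologyAnnihilatorOfDegree A (2 * d + 1) := by
  refine (Ideal.pow_right_mono (annihilator_ext_le_extAnnihilatorFrom hH) n).trans fun a ha => ?_
  rw [mem_cohomologyAnnihilatorOfDegree_iff_forall_mem_extAnnihilatorFrom]
  intro M hM
  obtain ⟨K, hK, hKT⟩ := hgen M hM
  have haK := pow_extAnnihilatorFrom_le_of_inTower G (d + 1) n K hKT ha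
  have := mem_extAnnihilatorFrom_of_isSyzygy d hK haK
  rwa [show d + 1 + d = 2 * d + 1 by ring] at this

/-- **Theorem 5.4** ([IyengarTakahashi2014]: for `R` a localisation of a finitely generated
algebra `A` of Krull dimension `d` over a field, `V(ca R) = V(ca^{2d+1} R) = Sing R`; the named
fact `singEqVCa_essFiniteType`) DERIVED FROM ITS PRINTED STRONG-GENERATION ASSERTION "there is a
finitely generated module `G` such that `Ω^d(mod A) ⊆ |G|ₙ` for some integer `n`", taken as the
hypothesis `hgen` in the vocabulary of this file (`G` finitely generated; for every finitely
generated `M` SOME `d`-th syzygy `Ω^d M` lies in `|G|ₙ`). The derivation is the printed one: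
Theorem 4.3 (`pow_annihilator_ext_le_cohomologyAnnihilatorOfDegree`, then
`singEqVCa_essFiniteType_of_exists_generator` of `AnnihilationOfCohomologyProofs.lean`).
[cite: IyengarTakahashi2014, Thm. 5.4] -/
theorem singEqVCa_essFiniteType_of_strongGenerator
    (hgen : ∀ (k : Type u) [Field k] (A : Type u) [CommRing A] [Algebra k A],
      Algebra.FiniteType k A → ∀ d : ℕ, ringKrullDim A = d →
        ∃ G : ModuleCat.{u} A, Module.Finite A G ∧ ∃ n : ℕ,
          ∀ M : ModuleCat.{u} A, Module.Finite A M → ∃ K : ModuleCat.{u} A,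
            IsSyzygy d M K ∧ InTower G n K) :
    singEqVCa_essFiniteType.{u} := by
  refine singEqVCa_essFiniteType_of_exists_generator fun k _ A _ _ hA d hd => ?_
  haveI : IsNoetherianRing A := Algebra.FiniteType.isNoetherianRing k A
  obtain ⟨G, hG, n, hGn⟩ := hgen k A hA d hd
  obtain ⟨H, hH, hHs⟩ := exists_isSyzygy G (d + 1)
  exact ⟨G, H, hG, hH, n, pow_annihilator_ext_le_cohomologyAnnihilatorOfDegree hGn hHs⟩

end Literature.RingTheory.CohomologyAnnihilator

end
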